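import Literature.AlgebraicGeometry.Resolution.AlterationsStrong
import Literature.AlgebraicGeometry.Resolution.ResolutionOfCurves
import Literature.AlgebraicGeometry.Motives.ProjectiveOfGeneratingSections
import Literature.AlgebraicGeometry.Motives.BaseChangeProofs
import Literature.AlgebraicGeometry.Motives.GeometricallyReducedPerfectField
import Mathlib.AlgebraicGeometry.IdealSheaf.IrreducibleComponent
import Mathlib.AlgebraicGeometry.Morphisms.UniversallyOpen
import Mathlib.FieldTheory.IsAlgClosed.AlgebraicClosure
import Mathlib.RingTheory.RingHom.Etale
import HarnessLib

/-!
# De Jong 1996, 4.5: reduction of Theorem 4.1 to an algebraically closed ground field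

Topic: `Literature/AlgebraicGeometry/Resolution`. Companion to `AlterationsStrong.lean`, which
vendors de Jong's alteration theorem in its strong form (`DeJong1996Strong`,
`DeJong1996StrongPerfect`, de Jong 1996, Thm. 4.1) and reduces its printed proof to two named
blocks, the first of which is **4.5**, `DeJong1996Descent`:
`DeJong1996StrongAlgClosed → DeJong1996Strong ∧ DeJong1996StrongPerfect` — Thm. 4.1 (with its
generically-étale clause) over algebraically closed fields gives Thm. 4.1 over every field and,
with the clause, over every perfect field. The printed 4.5 (p. 66) reads:

> "Let `k̄` be an algebraic closure of `k`. Let `X̄'` be an irreducible component of the scheme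
> `X ×_{Spec k} Spec k̄`, and let `Z̄'` be the inverse image of `Z` in `X̄'`. Suppose we can find
> `φ̄₁ : X̄₁ → X̄'` and `j̄₁ : X̄₁ → X̄̄₁` over `k̄` as in the theorem. There exists a finite
> extension `k₁` of `k` contained in `k̄` such that `X̄', X̄₁, X̄̄₁, φ̄₁` and `j̄₁` exist over
> `k₁`. Thus we have `X', X₁, X̄₁` and `j₁` over `k₁` and `φ₁' : X₁ → X'`, such that these give
> rise to `X̄', X̄₁, X̄̄₁, φ̄₁` and `j̄₁` over `k̄`. If we put `φ₁ : X₁ → X` equal to the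
> composition of `φ₁'` with the natural morphism `X' ↪ X ⊗ k₁ → X` then the quadruple
> `(X₁, X̄₁, φ₁, j₁)` is a solution to the problem posed in the theorem. (Note that if `φ̄₁` is
> generically étale then so is `φ₁'`, and if `k` is perfect, then `X' → X` will be generically
> étale too.) Therefore it suffices to prove the theorem under the additional hypothesis:
> (i) The field `k` is algebraically closed."

This file proves every step of 4.5 except the sentence "There exists a finite extension `k₁` …
such that `X̄', X̄₁, X̄̄₁, φ̄₁` and `j̄₁` exist over `k₁`" — the standard limit argument of
EGA IV₃ §8 (descent, through `k̄ = ⋃ k₁`, of a projective regular variety, an open immersion, an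
alteration, a strict normal crossings divisor and generic étaleness), of which Mathlib has so far
only the Hom-part (`Mathlib.AlgebraicGeometry.AffineTransitionLimit`, Stacks 01ZC) — which is
vendored as the named fact `DeJong1996.FiniteSubextension45`, the node left to discharge:

* `DeJong1996.map_eq_genericPoint_of_isGenericPoint`, `….isDominant_comp_of_mem_irreducibleComponents`:
  under a flat morphism to an integral scheme (here `X ⊗_k k' → X`) every irreducible component
  dominates (flat ⇒ generalizing, Mathlib `Flat.generalizingMap`);
* `DeJong1996.isAlteration_comp_fst`: "the natural morphism `X' ↪ X ⊗ k₁ → X`" is an alteration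
  (2.20) for `k ⊆ k₁` finite and `X'` an irreducible component of `X ⊗ k₁` with its integral
  closed-subscheme structure;
* `DeJong1996.isGenericallyEtale_comp_fst`: "if `k` is perfect, then `X' → X` will be
  generically étale too" (`X ⊗_k k₁` is then reduced, EGA IV₂ 4.6.1 via
  `Literature.AlgebraicGeometry.Motives.geometricallyReduced_SpecMap_of_perfectField`, and
  `Spec k₁ → Spec k` is étale);
* `DeJong1996.isProjectiveOver_restrictScalars`, `….ConclusionGenericallyEtale.restrictScalars`:
  a projective `k₁`-scheme is projective over `k` (Görtz–Wedhorn I, Thm. 13.84 (2) with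
  Cor. 13.72, `Literature.AlgebraicGeometry.Motives.isProjectiveOver_of_isAffineHom`, and
  `ℙⁿ_{k₁} ≅ ℙⁿ_k ⊗_k k₁`, `….projectiveSpaceBaseChangeIso`), so a solution over `k₁` is a
  solution over `k`;
* `DeJong1996.exists_conclusionGenericallyEtale_over_finite`: the choice of `X̄'` (an
  irreducible component of `X ⊗_k k̄` with its integral structure,
  `isIntegral_subscheme_vanishingIdeal`) as a variety over `k̄` with `Z̄'` a proper closed subset,
  Thm. 4.1 over `k̄`, and the limit fact;
* `DeJong1996Descent.of_finiteSubextension45 : FiniteSubextension45 → DeJong1996Descent`, the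
  assembly (with 4.4, `Conclusion.of_isAlteration` / `ConclusionGenericallyEtale.of_isAlteration`
  of `AlterationsStrong.lean`), and the corollaries `DeJong1996Strong(Perfect).of_algClosed_…`,
  `DeJong1996Strong.of_finiteSubextension45_of_inductionStep`.

## Sources

* A. J. de Jong, *Smoothness, semi-stability and alterations*, Publ. Math. IHÉS 83 (1996) 51–93:
  2.2, 2.9, 2.20, Thm. 4.1, 4.4, 4.5 (p. 66).
* A. Grothendieck, J. Dieudonné, EGA IV₂ (1965) Prop. 4.6.1; EGA IV₃ (1966) §8 (8.8.2, 8.10.5);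
  EGA IV₄ (1967) 17.7.8 — the limit formalism behind "exist over `k₁`".
* U. Görtz, T. Wedhorn, *Algebraic Geometry I*, 2nd ed. (2020), Thm. 13.84, Cor. 13.72.
-/

noncomputable section

open CategoryTheory CategoryTheory.Limits AlgebraicGeometry TopologicalSpace

namespace Literature.AlgebraicGeometry.Resolution

universe u

namespace DeJong1996

/-! ## Irreducible components of a flat cover dominate -/

section Dominant

variable {X Y : Scheme.{u}}

/-- Under a flat morphism `p : Y → X` to an integral scheme, the generic point of every
irreducible component of `Y` maps to the generic point of `X`: flat morphisms are generalizing
(Mathlib `Flat.generalizingMap`, going down), so the generization `η_X ⤳ p(c)` lifts to some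
`c' ⤳ c` over `η_X`, and `closure {c'} ⊇ C` forces `c' = c` by maximality of `C`. [folklore] -/
theorem map_eq_genericPoint_of_isGenericPoint (p : Y ⟶ X) [Flat p] [IsIntegral X] {C : Set Y}
    (hC : C ∈ irreducibleComponents (Y : Type u)) {c : Y} (hc : IsGenericPoint c C) :
    p c = genericPoint X := by
  have hgen := Flat.generalizingMap p
  obtain ⟨c', hc'c, hc'η⟩ := hgen (genericPoint_specializes (p c))
  -- `closure {c'}` is an irreducible closed set containing `C = closure {c}`
  have h1 : C ⊆ closure ({c'} : Set Y) := by
    rw [← hc.def]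
    exact closure_minimal (Set.singleton_subset_iff.mpr (specializes_iff_mem_closure.mp hc'c))
      isClosed_closure
  have h2 : closure ({c'} : Set Y) ⊆ C := hC.2 isIrreducible_singleton.closure h1
  have h3 : c' ∈ C := h2 (subset_closure (Set.mem_singleton c'))
  have h4 : c ⤳ c' := hc.specializes h3
  have : c' = c := (hc'c.antisymm h4).eq
  rw [← this, hc'η]

/-- A closed immersion `ι : X' → Y` from an irreducible scheme whose image is an irreducible
component of `Y`, followed by a flat morphism `p : Y → X` to an integral scheme, sends the
generic point of `X'` to the generic point of `X`. [folklore] -/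
theorem comp_apply_genericPoint_eq (p : Y ⟶ X) [Flat p] [IsIntegral X] {X' : Scheme.{u}}
    [IrreducibleSpace X'] (ι : X' ⟶ Y) [IsClosedImmersion ι]
    (hC : Set.range ι ∈ irreducibleComponents (Y : Type u)) :
    (ι ≫ p) (genericPoint X') = genericPoint X := by
  rw [Scheme.Hom.comp_apply]
  apply map_eq_genericPoint_of_isGenericPoint p hC
  have h := (genericPoint_spec X').image ι.continuous
  rwa [Set.image_univ, ι.isClosedEmbedding.isClosed_range.closure_eq] at h

/-- In the situation of `comp_apply_genericPoint_eq`, `ι ≫ p` is dominant. [folklore] -/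
theorem isDominant_comp_of_mem_irreducibleComponents (p : Y ⟶ X) [Flat p] [IsIntegral X]
    {X' : Scheme.{u}} [IrreducibleSpace X'] (ι : X' ⟶ Y) [IsClosedImmersion ι]
    (hC : Set.range ι ∈ irreducibleComponents (Y : Type u)) : IsDominant (ι ≫ p) := by
  refine ⟨dense_iff_closure_eq.mpr (Set.eq_univ_of_univ_subset ?_)⟩
  rw [← (genericPoint_spec X).def]
  exact closure_mono (Set.singleton_subset_iff.mpr ⟨genericPoint X', comp_apply_genericPoint_eq p ι hC⟩)

end Dominant

/-! ## `X' ↪ X ⊗_k k₁ → X` is an alteration (de Jong 1996, 4.5) -/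

section Alteration

variable {k : Type u} [Field k] (k₁ : Type u) [Field k₁] [Algebra k k₁]
  {X : Scheme.{u}} (f : X ⟶ Spec (.of k))

/-- `Spec k₁ → Spec k` is finite for a finite extension `k ⊆ k₁`. [folklore] -/
theorem isFinite_specMap_of_finite [Module.Finite k k₁] :
    IsFinite (Spec.map (CommRingCat.ofHom (algebraMap k k₁))) := by
  rw [IsFinite.SpecMap_iff, CommRingCat.hom_ofHom, RingHom.finite_algebraMap]
  infer_instance

/-- `Spec k₁ → Spec k` is étale for a finite separable extension `k ⊆ k₁`. [folklore] -/
theorem etale_specMap_of_isSeparable [Module.Finite k k₁] [Algebra.IsSeparable k k₁] :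
    Etale (Spec.map (CommRingCat.ofHom (algebraMap k k₁))) := by
  rw [HasRingHomProperty.Spec_iff (P := @Etale), CommRingCat.hom_ofHom, RingHom.etale_algebraMap]
  haveI : Algebra.FormallyEtale k k₁ := Algebra.FormallyEtale.of_isSeparable k k₁
  haveI : Algebra.FinitePresentation k k₁ := (Algebra.FinitePresentation.of_finiteType).mp
    inferInstance
  exact ⟨‹_›, ‹_›⟩

variable {k₁}

/-- **de Jong 1996, 4.5: "the natural morphism `X' ↪ X ⊗ k₁ → X`" is an alteration** for an
irreducible component `X'` (with its integral closed-subscheme structure) of `X ⊗_k k₁`,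
`k ⊆ k₁` finite, `X` a variety: it is finite (a closed immersion followed by the base change of
the finite `Spec k₁ → Spec k`), hence proper and finite over all of `X`, and dominant because
`X ⊗_k k₁ → X` is flat (`isDominant_comp_of_mem_irreducibleComponents`).
[cite: DeJong1996, 4.5, p. 66] -/
theorem isAlteration_comp_fst [Module.Finite k k₁] [IsIntegral X] {X' : Scheme.{u}}
    [IsIntegral X'] (ι' : X' ⟶ pullback f (Spec.map (CommRingCat.ofHom (algebraMap k k₁))))
    [IsClosedImmersion ι']
    (hC : Set.range ι' ∈ irreducibleComponents
      (↑(pullback f (Spec.map (CommRingCat.ofHom (algebraMap k k₁)))) : Type u)) :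
    IsAlteration (ι' ≫ pullback.fst f (Spec.map (CommRingCat.ofHom (algebraMap k k₁)))) := by
  haveI := isFinite_specMap_of_finite (k := k) k₁
  haveI : IsFinite (ι' ≫ pullback.fst f (Spec.map (CommRingCat.ofHom (algebraMap k k₁)))) :=
    inferInstance
  exact
    { isIntegral := ‹_›
      isProper := inferInstance
      isDominant := isDominant_comp_of_mem_irreducibleComponents _ ι' hC
      exists_isFinite := ⟨⊤, by simp, inferInstance⟩ }

end Alteration

/-! ## Restriction of scalars along a finite extension `k ⊆ k₁` -/

section RestrictScalars

open Literature.AlgebraicGeometry.Motives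

variable {k : Type u} [Field k] {k₁ : Type u} [Field k₁] [Algebra k k₁] [Module.Finite k k₁]

/-- **A projective `k₁`-scheme is projective over `k`** for `k ⊆ k₁` finite: `Y → Spec k₁ → Spec k`
is proper, and `Y ↪ ℙⁿ_{k₁} ≅ ℙⁿ_k ×_k Spec k₁ → ℙⁿ_k` is an affine `k`-morphism (a closed
immersion followed by the base change of the finite `Spec k₁ → Spec k`), so `Y` is projective
over `k` by Görtz–Wedhorn I, Thm. 13.84 (2) with Cor. 13.72
(`Literature.AlgebraicGeometry.Motives.isProjectiveOver_of_isAffineHom`). This is the step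
"`X̄₁` [projective over `k₁`] is a projective variety [over `k`]" of de Jong 1996, 4.5.
[folklore] -/
theorem isProjectiveOver_restrictScalars {Y : Scheme.{u}} (q : Y ⟶ Spec (.of k₁))
    (h : IsProjectiveOver (Over.mk q)) :
    IsProjectiveOver (Over.mk (q ≫ Spec.map (CommRingCat.ofHom (algebraMap k k₁)))) := by
  obtain ⟨n, c, hc⟩ := h
  haveI : IsFinite (Spec.map (CommRingCat.ofHom (algebraMap k k₁))) :=
    isFinite_specMap_of_finite (k := k) k₁
  let e := projectiveSpaceBaseChangeIso k k₁ n
  let c' : Y ⟶ (projectiveSpace n k₁).left := c.left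
  let e' : (projectiveSpace n k₁).left ⟶
      pullback (projectiveSpace n k).hom (Spec.map (CommRingCat.ofHom (algebraMap k k₁))) :=
    e.hom.left
  let r : Y ⟶ (projectiveSpace n k).left :=
    c' ≫ e' ≫ pullback.fst (projectiveSpace n k).hom (Spec.map (CommRingCat.ofHom (algebraMap k k₁)))
  have h1 : e' ≫ pullback.snd (projectiveSpace n k).hom
      (Spec.map (CommRingCat.ofHom (algebraMap k k₁))) = (projectiveSpace n k₁).hom :=
    Over.w e.hom
  have h2 : c' ≫ (projectiveSpace n k₁).hom = q := Over.w c
  have h3 : pullback.fst (projectiveSpace n k).hom (Spec.map (CommRingCat.ofHom (algebraMap k k₁))) ≫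
      (projectiveSpace n k).hom = pullback.snd (projectiveSpace n k).hom
        (Spec.map (CommRingCat.ofHom (algebraMap k k₁))) ≫
          Spec.map (CommRingCat.ofHom (algebraMap k k₁)) :=
    pullback.condition
  have hr : r ≫ (projectiveSpace n k).hom = q ≫ Spec.map (CommRingCat.ofHom (algebraMap k k₁)) := by
    change (c' ≫ e' ≫ pullback.fst _ _) ≫ _ = _
    rw [Category.assoc, Category.assoc, h3, reassoc_of% h1, reassoc_of% h2]
  haveI : IsProper q := IsProjectiveOver.isProper (X := Over.mk q) ⟨n, c, hc⟩
  haveI : IsProper (Over.mk (q ≫ Spec.map (CommRingCat.ofHom (algebraMap k k₁)))).hom := by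
    change IsProper (q ≫ _)
    infer_instance
  haveI : IsClosedImmersion c' := hc
  haveI : IsIso e' := inferInstanceAs (IsIso ((Over.forget _).map e.hom))
  haveI : IsAffineHom r := by
    change IsAffineHom (c' ≫ e' ≫ pullback.fst _ _)
    infer_instance
  haveI : IsAffineHom (Over.homMk r hr :
      Over.mk (q ≫ Spec.map (CommRingCat.ofHom (algebraMap k k₁))) ⟶ projectiveSpace n k).left := by
    change IsAffineHom r
    infer_instance
  exact isProjectiveOver_of_isAffineHom
    (Z := Over.mk (q ≫ Spec.map (CommRingCat.ofHom (algebraMap k k₁)))) (Over.homMk r hr)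

/-- The conclusion of Thm. 4.1 (with the generically-étale clause) for `Y → Spec k₁` gives it for
`Y → Spec k₁ → Spec k`, `k ⊆ k₁` finite: all conditions are absolute except projectivity, which
restricts along finite extensions (`isProjectiveOver_restrictScalars`). This is the sentence
"the quadruple `(X₁, X̄₁, φ₁, j₁)` is a solution to the problem posed in the theorem" of
de Jong 1996, 4.5, as far as the compactification `X̄₁` is concerned.
[cite: DeJong1996, 4.5, p. 66] -/
theorem ConclusionGenericallyEtale.restrictScalars {Y : Scheme.{u}} {q : Y ⟶ Spec (.of k₁)}
    {Z : Set Y} (h : ConclusionGenericallyEtale q Z) :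
    ConclusionGenericallyEtale (q ≫ Spec.map (CommRingCat.ofHom (algebraMap k k₁))) Z := by
  obtain ⟨X₁, Xbar₁, φ₁, j₁, g, h₁, h₂, h₃, h₄, h₅, h₆, h₇, h₈⟩ := h
  refine ⟨X₁, Xbar₁, φ₁, j₁, g ≫ Spec.map (CommRingCat.ofHom (algebraMap k k₁)), h₁, h₂, h₃,
    isProjectiveOver_restrictScalars g h₄, h₅, ?_, h₇, h₈⟩
  rw [← Category.assoc, h₆, Category.assoc]

end RestrictScalars

/-! ## `X' ↪ X ⊗_k k₁ → X` is generically étale when `k` is perfect (de Jong 1996, 4.5) -/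

section GenericallyEtale

open Literature.AlgebraicGeometry.Motives Scheme.IdealSheafData

variable {k : Type u} [Field k] {k₁ : Type u} [Field k₁] [Algebra k k₁]
  {X : Scheme.{u}} (f : X ⟶ Spec (.of k))

/-- The open complement of the other irreducible components is contained in the given component.
[folklore] -/
theorem irreducibleComponentOpen_subset {Y : Scheme.{u}} [IsNoetherian Y] {C : Set Y}
    (hC : C ∈ irreducibleComponents (Y : Type u)) :
    ((Scheme.irreducibleComponentOpen Y C : Y.Opens) : Set Y) ⊆ C := by
  intro y hy
  by_contra hyC
  apply hy
  refine Set.mem_sUnion.mpr ⟨irreducibleComponent y, ⟨irreducibleComponent_mem_irreducibleComponents y,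
    ?_⟩, mem_irreducibleComponent⟩
  rintro rfl
  exact hyC mem_irreducibleComponent

/-- The generic point of an irreducible component lies in no other irreducible component, i.e. it
lies in the open complement of the other components. [folklore] -/
theorem mem_irreducibleComponentOpen_of_isGenericPoint {Y : Scheme.{u}} [IsNoetherian Y]
    {C : Set Y} (hC : C ∈ irreducibleComponents (Y : Type u)) {c : Y} (hc : IsGenericPoint c C) :
    c ∈ (Scheme.irreducibleComponentOpen Y C : Y.Opens) := by
  change c ∈ (⋃₀ (irreducibleComponents (Y : Type u) \ {C}))ᶜ
  rintro ⟨C', ⟨hC', hne⟩, hcC'⟩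
  apply hne
  have h1 : C ⊆ C' := by
    rw [← hc.def]
    exact closure_minimal (Set.singleton_subset_iff.mpr hcC')
      (isClosed_of_mem_irreducibleComponents C' hC')
  exact Set.Subset.antisymm (hC.2 hC'.1 h1) h1

/-- **de Jong 1996, 4.5: "if `k` is perfect, then `X' → X` will be generically étale too."** For
`k` perfect, `k ⊆ k₁` finite (hence separable, so `Spec k₁ → Spec k` is étale) and `X'` an
irreducible component of `X ⊗_k k₁` with its integral closed-subscheme structure, `X`
a variety: `X ⊗_k k₁` is reduced (EGA IV₂ 4.6.1, `geometricallyReduced_SpecMap_of_perfectField`),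
so over the open complement `W` of the other components the closed immersion `X' ↪ X ⊗_k k₁`
restricts to an isomorphism, and `X' ⊇ W ≅ W ⊆ X ⊗_k k₁ → X` is étale on the dense open `W`.
[cite: DeJong1996, 4.5, p. 66] -/
theorem isGenericallyEtale_comp_fst [PerfectField k] [Module.Finite k k₁] [IsIntegral X]
    [LocallyOfFiniteType f] [QuasiCompact f] {X' : Scheme.{u}} [IsIntegral X']
    (ι' : X' ⟶ pullback f (Spec.map (CommRingCat.ofHom (algebraMap k k₁))))
    [IsClosedImmersion ι']
    (hC : Set.range ι' ∈ irreducibleComponents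
      (↑(pullback f (Spec.map (CommRingCat.ofHom (algebraMap k k₁)))) : Type u)) :
    IsGenericallyEtale (ι' ≫ pullback.fst f (Spec.map (CommRingCat.ofHom (algebraMap k k₁)))) := by
  haveI : IsFinite (Spec.map (CommRingCat.ofHom (algebraMap k k₁))) :=
    isFinite_specMap_of_finite (k := k) k₁
  haveI : Etale (Spec.map (CommRingCat.ofHom (algebraMap k k₁))) :=
    etale_specMap_of_isSeparable (k := k) k₁
  haveI : GeometricallyReduced (Spec.map (CommRingCat.ofHom (algebraMap k k₁))) :=
    geometricallyReduced_SpecMap_of_perfectField k k₁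
  haveI : IsLocallyNoetherian X := LocallyOfFiniteType.isLocallyNoetherian f
  haveI : CompactSpace X := (HasAffineProperty.iff_of_isAffine (P := @QuasiCompact)).mp ‹_›
  haveI : IsReduced ↑(pullback f (Spec.map (CommRingCat.ofHom (algebraMap k k₁)))) :=
    inferInstance
  haveI : IsLocallyNoetherian ↑(pullback f (Spec.map (CommRingCat.ofHom (algebraMap k k₁)))) :=
    LocallyOfFiniteType.isLocallyNoetherian (pullback.snd f _)
  haveI : CompactSpace ↑(pullback f (Spec.map (CommRingCat.ofHom (algebraMap k k₁)))) :=
    QuasiCompact.compactSpace_of_compactSpace (pullback.fst f _)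
  haveI : IsNoetherian ↑(pullback f (Spec.map (CommRingCat.ofHom (algebraMap k k₁)))) := {}
  -- the open complement `W` of the other components, contained in `C = range ι'`
  let W : (pullback f (Spec.map (CommRingCat.ofHom (algebraMap k k₁)))).Opens :=
    Scheme.irreducibleComponentOpen _ (Set.range ι')
  have hWC : (W : Set ↑(pullback f (Spec.map (CommRingCat.ofHom (algebraMap k k₁))))) ⊆
      Set.range ι' := irreducibleComponentOpen_subset hC
  have hgen : IsGenericPoint (ι' (genericPoint X')) (Set.range ι') := by
    have h := (genericPoint_spec X').image ι'.continuous
    rwa [Set.image_univ, ι'.isClosedEmbedding.isClosed_range.closure_eq] at h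
  have hηW : ι' (genericPoint X') ∈ W := mem_irreducibleComponentOpen_of_isGenericPoint hC hgen
  -- `ι'` restricts to an isomorphism over `W`
  haveI : Surjective (ι' ∣_ W) := by
    refine ⟨fun w => ?_⟩
    obtain ⟨x, hx⟩ := hWC w.2
    refine ⟨⟨x, show ι' x ∈ W by rw [hx]; exact w.2⟩, Subtype.ext ?_⟩
    rw [morphismRestrict_base]
    exact hx
  haveI : IsIso (ι' ∣_ W) := isIso_of_isClosedImmersion_of_surjective _
  refine ⟨ι' ⁻¹ᵁ W, (ι' ⁻¹ᵁ W).isOpen.dense ⟨genericPoint X', hηW⟩, ?_⟩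
  rw [← Category.assoc, ← morphismRestrict_ι, Category.assoc]
  infer_instance

end GenericallyEtale

/-! ## The limit argument of 4.5 as a named fact -/

/-- NAMED FACT — **de Jong 1996, 4.5, the limit argument** ("`X̄', X̄₁, X̄̄₁, φ̄₁` and `j̄₁`
exist over `k₁`"): "Let `k̄` be an algebraic closure of `k`. Let `X̄'` be an irreducible
component of the scheme `X ×_{Spec k} Spec k̄`, and let `Z̄'` be the inverse image of `Z` in
`X̄'`. Suppose we can find `φ̄₁ : X̄₁ → X̄'` and `j̄₁ : X̄₁ → X̄̄₁` over `k̄` as in the theorem.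
There exists a finite extension `k₁` of `k` contained in `k̄` such that `X̄', X̄₁, X̄̄₁, φ̄₁` and
`j̄₁` exist over `k₁`. Thus we have `X'`, `X₁`, `X̄₁` and `j₁` over `k₁` and `φ₁' : X₁ → X'`,
such that these give rise to `X̄', X̄₁, X̄̄₁, φ̄₁` and `j̄₁` over `k̄`. […] (Note that if `φ̄₁`
is generically étale then so is `φ₁'` […])" — here `X` is a variety over `k` (2.9), `Z ⊂ X` is
closed, the irreducible component `X̄'` carries its integral closed-subscheme structure
(2.2) and `X'` is an irreducible component of `X ⊗ k₁` ("the natural morphism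
`X' ↪ X ⊗ k₁`"). Rendered as the consequence the proof of Thm. 4.1 uses: if the conclusion of
Thm. 4.1 with its generically-étale clause (`ConclusionGenericallyEtale`) holds for
`(X̄' → Spec k̄, Z̄')`, then for some finite subextension `k ⊆ k₁ ⊆ k̄` and some irreducible
component `X'` of `X ⊗_k k₁` (an integral closed subscheme `ι' : X' ↪ X ⊗_k k₁` whose image is
an irreducible component) it holds for `(X' → Spec k₁, Z')`, `Z'` the inverse image of `Z`;
the comparison isomorphisms with the data over `k̄` are not recorded. The printed proof is the
standard limit argument (EGA IV₃ §8: 8.8.2, 8.10.5; EGA IV₄ 17.7.8), which Mathlib has only in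
part (`Mathlib.AlgebraicGeometry.AffineTransitionLimit`); this is the node of 4.5 left to
discharge, everything else in 4.5 being proved in this file. Users take
`(h : DeJong1996.FiniteSubextension45)`. [cite: DeJong1996, 4.5, p. 66] -/
def FiniteSubextension45 : Prop :=
  ∀ (k : Type u) [Field k] (K : Type u) [Field K] [Algebra k K] [IsAlgClosure k K]
    (X : Scheme.{u}) (f : X ⟶ Spec (.of k)) [IsIntegral X] [IsSeparated f]
    [LocallyOfFiniteType f] [QuasiCompact f] (Z : Set X), IsClosed Z → Z ≠ Set.univ →
    ∀ (Xb : Scheme.{u}) (ιb : Xb ⟶ pullback f (Spec.map (CommRingCat.ofHom (algebraMap k K))))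
      [IsIntegral Xb] [IsClosedImmersion ιb],
      Set.range ιb ∈ irreducibleComponents
        (↑(pullback f (Spec.map (CommRingCat.ofHom (algebraMap k K)))) : Type u) →
      ConclusionGenericallyEtale
        (ιb ≫ pullback.snd f (Spec.map (CommRingCat.ofHom (algebraMap k K))))
        ((ιb ≫ pullback.fst f (Spec.map (CommRingCat.ofHom (algebraMap k K)))) ⁻¹' Z) →
      ∃ (k₁ : IntermediateField k K) (_ : FiniteDimensional k k₁) (X' : Scheme.{u})
        (ι' : X' ⟶ pullback f (Spec.map (CommRingCat.ofHom (algebraMap k k₁)))),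
        IsIntegral X' ∧ IsClosedImmersion ι' ∧
        Set.range ι' ∈ irreducibleComponents
          (↑(pullback f (Spec.map (CommRingCat.ofHom (algebraMap k k₁)))) : Type u) ∧
        ConclusionGenericallyEtale
          (ι' ≫ pullback.snd f (Spec.map (CommRingCat.ofHom (algebraMap k k₁))))
          ((ι' ≫ pullback.fst f (Spec.map (CommRingCat.ofHom (algebraMap k k₁)))) ⁻¹' Z)

/-! ## 4.5: choosing the component `X̄'` and assembling -/

section Assembly

open Scheme.IdealSheafData

variable {k : Type u} [Field k]

/-- The generic point of an integral scheme does not lie in a proper closed subset. [folklore] -/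
theorem genericPoint_notMem_of_isClosed {X : Scheme.{u}} [IsIntegral X] {Z : Set X}
    (hZ : IsClosed Z) (hZ' : Z ≠ Set.univ) : genericPoint X ∉ Z := fun h =>
  hZ' (Set.eq_univ_of_univ_subset (by
    rw [← (genericPoint_spec X).def]
    exact closure_minimal (Set.singleton_subset_iff.mpr h) hZ))

/-- **de Jong 1996, 4.5, first half**: "Let `k̄` be an algebraic closure of `k`. Let `X̄'` be an
irreducible component of the scheme `X ×_{Spec k} Spec k̄`, and let `Z̄'` be the inverse image of
`Z` in `X̄'`" — `X̄'`, with its integral closed-subscheme structure, is a variety over the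
algebraically closed field `k̄` and `Z̄'` is a proper closed subset (the generic point of `X̄'`
maps to that of `X`, `X ⊗_k k̄ → X` being flat), so Thm. 4.1 over algebraically closed fields
(`DeJong1996StrongAlgClosed`) applies to `(X̄', Z̄')`, and the limit argument
(`FiniteSubextension45`) descends its conclusion to an irreducible component `X'` of `X ⊗_k k₁`
for a finite extension `k ⊆ k₁`. [cite: DeJong1996, 4.5, p. 66] -/
theorem exists_conclusionGenericallyEtale_over_finite (H : FiniteSubextension45.{u})
    (hAC : DeJong1996StrongAlgClosed.{u}) (X : Scheme.{u}) (f : X ⟶ Spec (.of k)) [IsIntegral X]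
    [IsSeparated f] [LocallyOfFiniteType f] [QuasiCompact f] {Z : Set X} (hZ : IsClosed Z)
    (hZ' : Z ≠ Set.univ) :
    ∃ (k₁ : IntermediateField k (AlgebraicClosure k)) (_ : FiniteDimensional k k₁)
      (X' : Scheme.{u})
      (ι' : X' ⟶ pullback f (Spec.map (CommRingCat.ofHom (algebraMap k k₁)))),
      IsIntegral X' ∧ IsClosedImmersion ι' ∧
      Set.range ι' ∈ irreducibleComponents
        (↑(pullback f (Spec.map (CommRingCat.ofHom (algebraMap k k₁)))) : Type u) ∧
      ConclusionGenericallyEtale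
        (ι' ≫ pullback.snd f (Spec.map (CommRingCat.ofHom (algebraMap k k₁))))
        ((ι' ≫ pullback.fst f (Spec.map (CommRingCat.ofHom (algebraMap k k₁)))) ⁻¹' Z) := by
  let K := AlgebraicClosure k
  set s := Spec.map (CommRingCat.ofHom (algebraMap k K)) with hs
  set Y := pullback f s
  -- `Y = X ⊗_k k̄` is non-empty; choose an irreducible component `C`
  haveI : Nonempty Y := by
    obtain ⟨y, -⟩ := (pullback.fst f s).surjective (genericPoint X)
    exact ⟨y⟩
  let y₀ : Y := Classical.arbitrary Y
  let C : Set Y := irreducibleComponent y₀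
  have hC : C ∈ irreducibleComponents (Y : Type u) := irreducibleComponent_mem_irreducibleComponents y₀
  let Cc : Closeds Y := ⟨C, isClosed_irreducibleComponent⟩
  let Xb : Scheme.{u} := (vanishingIdeal Cc).subscheme
  let ιb : Xb ⟶ Y := (vanishingIdeal Cc).subschemeι
  haveI : IsIntegral Xb := isIntegral_subscheme_vanishingIdeal Cc hC.1
  have hrange : Set.range ιb = C := range_subschemeι_vanishingIdeal Cc
  have hCb : Set.range ιb ∈ irreducibleComponents (Y : Type u) := hrange ▸ hC
  -- `Z̄'` is a proper closed subset of `X̄'`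
  have hZb : IsClosed ((ιb ≫ pullback.fst f s) ⁻¹' Z) :=
    hZ.preimage (ιb ≫ pullback.fst f s).continuous
  have hZb' : (ιb ≫ pullback.fst f s) ⁻¹' Z ≠ Set.univ := by
    intro h
    have hη : genericPoint Xb ∈ (ιb ≫ pullback.fst f s) ⁻¹' Z := h ▸ Set.mem_univ _
    rw [Set.mem_preimage, comp_apply_genericPoint_eq (pullback.fst f s) ιb hCb] at hη
    exact genericPoint_notMem_of_isClosed hZ hZ' hη
  -- Thm. 4.1 over `k̄`, then the limit argument
  have h := hAC K Xb (ιb ≫ pullback.snd f s) ((ιb ≫ pullback.fst f s) ⁻¹' Z) inferInstance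
    inferInstance inferInstance inferInstance hZb hZb'
  exact H k K X f Z hZ hZ' Xb ιb hCb h

/-- **de Jong 1996, 4.5: reduction of Thm. 4.1 to an algebraically closed ground field**, from
the limit argument `FiniteSubextension45`: Thm. 4.1 with its generically-étale clause over
algebraically closed fields implies Thm. 4.1 over every field and, with the clause, over every
perfect field. "If we put `φ₁ : X₁ → X` equal to the composition of `φ₁'` with the natural
morphism `X' ↪ X ⊗ k₁ → X` then the quadruple `(X₁, X̄₁, φ₁, j₁)` is a solution to the problem
posed in the theorem. (Note that if `φ̄₁` is generically étale then so is `φ₁'`, and if `k` is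
perfect, then `X' → X` will be generically étale too.)": `X' → X` is an alteration
(`isAlteration_comp_fst`), generically étale for `k` perfect (`isGenericallyEtale_comp_fst`),
`X̄₁` is projective over `k` (`ConclusionGenericallyEtale.restrictScalars`), and alterations
(generically étale ones) compose (4.4, `Conclusion.of_isAlteration`,
`ConclusionGenericallyEtale.of_isAlteration`). [cite: DeJong1996, 4.5, p. 66] -/
theorem _root_.Literature.AlgebraicGeometry.Resolution.DeJong1996Descent.of_finiteSubextension45
    (H : FiniteSubextension45.{u}) : DeJong1996Descent.{u} := by
  intro hAC
  constructor
  · intro k _ X f Z hs hl hq hi hZ hZ'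
    obtain ⟨k₁, hfin, X', ι', hi', hc', hC, h⟩ :=
      exists_conclusionGenericallyEtale_over_finite H hAC X f hZ hZ'
    haveI := hfin
    have hφ := isAlteration_comp_fst (k₁ := k₁) f ι' hC
    have h' := (ConclusionGenericallyEtale.restrictScalars (k := k) h).conclusion
    rw [Category.assoc, ← pullback.condition, ← Category.assoc] at h'
    exact Conclusion.of_isAlteration hφ h'
  · intro k _ _ X f Z hs hl hq hi hZ hZ'
    obtain ⟨k₁, hfin, X', ι', hi', hc', hC, h⟩ :=
      exists_conclusionGenericallyEtale_over_finite H hAC X f hZ hZ'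
    haveI := hfin
    have hφ := isAlteration_comp_fst (k₁ := k₁) f ι' hC
    have hφe := isGenericallyEtale_comp_fst (k₁ := k₁) f ι' hC
    have h' := ConclusionGenericallyEtale.restrictScalars (k := k) h
    rw [Category.assoc, ← pullback.condition, ← Category.assoc] at h'
    exact ConclusionGenericallyEtale.of_isAlteration hφ hφe h'

end Assembly

end DeJong1996

/-- `DeJong1996Strong` (Thm. 4.1 (i)+(ii) over every field) from Thm. 4.1 over algebraically
closed fields and the limit argument of 4.5. [cite: DeJong1996, 4.5, p. 66] -/
theorem DeJong1996Strong.of_algClosed_of_finiteSubextension45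
    (H : DeJong1996.FiniteSubextension45.{u}) (hAC : DeJong1996StrongAlgClosed.{u}) :
    DeJong1996Strong.{u} :=
  (DeJong1996Descent.of_finiteSubextension45 H hAC).1

/-- `DeJong1996StrongPerfect` (Thm. 4.1 with its last sentence, over perfect fields) from
Thm. 4.1 over algebraically closed fields and the limit argument of 4.5.
[cite: DeJong1996, 4.5, p. 66] -/
theorem DeJong1996StrongPerfect.of_algClosed_of_finiteSubextension45
    (H : DeJong1996.FiniteSubextension45.{u}) (hAC : DeJong1996StrongAlgClosed.{u}) :
    DeJong1996StrongPerfect.{u} :=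
  (DeJong1996Descent.of_finiteSubextension45 H hAC).2

/-- The printed proof of Thm. 4.1 assembled down to its two remaining named blocks: the limit
argument of 4.5 (`DeJong1996.FiniteSubextension45`) and the induction step 4.6–4.28
(`DeJong1996InductionStep`). [cite: DeJong1996, 4.3–4.5, p. 66] -/
theorem DeJong1996Strong.of_finiteSubextension45_of_inductionStep
    (H : DeJong1996.FiniteSubextension45.{u}) (hstep : DeJong1996InductionStep.{u}) :
    DeJong1996Strong.{u} ∧ DeJong1996StrongPerfect.{u} :=
  DeJong1996Descent.of_finiteSubextension45 H (DeJong1996StrongAlgClosed.of_inductionStep hstep)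

end Literature.AlgebraicGeometry.Resolution

end
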